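import Summits.Ventures.PercRepro.C041SeedCoverMain
import Summits.Ventures.PercRepro.C041SeedCoverTinyB
import Summits.Ventures.PercRepro.C041SeedCoverTinyA
import Summits.Ventures.PercRepro.C041TriangleMarkLeaf

/-!
# THE LAST SEED ON EVERY STAR (mine-3, gen 65; C-041.md §21 (az)/(ba))

`θ_△(v 1, V a) ∈ cone` for every star with at least two leaves: the three covers
`InCone_thetaTri_v1_V_main` (`A ≥ 1/2 ∨ P₁ ≥ 9/2 ∨ (B ≤ 1/2 ∧ (P₁ ≥ 6/5 ∨ A > 1/20))`),
`InCone_thetaTri_v1_V_tinyB` (`B ≥ 1/2`) and `InCone_thetaTri_v1_V_tinyA` (`A ≤ 1/20`, `B ≤ 1/2`, `P₁ ≤ 6/5`)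
exhaust the invariants `A = ∏ a i`, `B = ∏ (1 - a i)`, `P₁ = ∏ (1 + a i ^ 2)`.  With the empty star
(`θ_△(v 1, 𝟙) = 6 𝟙 + 5 v 1`) and the one-leaf star (`InCone_thetaTri_pow_one_v` of `C041TriangleMarkLeaf`) this is
`InCone_thetaTri_v1_V`: the seed on every star `V a`, `a : Fin m → ℝ`, for every `m`.
-/

namespace PercRepro

namespace RelaxedTriangle

open TreeClosure

/-- **THEOREM (THE LAST SEED)**: `θ_△(v 1, V a) ∈ cone` for every star `V a` with at least two leaves in `[0, 1]`. -/
theorem InCone_thetaTri_v1_V_all {m : ℕ} (a : Fin (m + 2) → ℝ) (ha : ∀ i, 0 ≤ a i ∧ a i ≤ 1) :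
    InCone (thetaTri (v 1) (V a)) := by
  rcases le_or_gt (1 / 2 : ℝ) (∏ i, (1 - a i)) with hB | hB
  · exact InCone_thetaTri_v1_V_tinyB a ha hB
  · rcases le_or_gt (∏ i, a i) (1 / 20 : ℝ) with hA | hA
    · rcases le_or_gt (∏ i, (1 + a i ^ 2)) (6 / 5 : ℝ) with hP | hP
      · exact InCone_thetaTri_v1_V_tinyA a ha hA hB.le hP
      · exact InCone_thetaTri_v1_V_main a ha (Or.inr (Or.inr ⟨hB.le, Or.inl hP.le⟩))
    · exact InCone_thetaTri_v1_V_main a ha (Or.inr (Or.inr ⟨hB.le, Or.inr hA⟩))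

/-- The empty star: `θ_△(v 1, 𝟙) = 6 • 𝟙 + 5 • v 1`. -/
theorem thetaTri_v1_one : thetaTri (v 1) (1 : Vec6) = (6 : ℝ) • (1 : Vec6) + (5 : ℝ) • v 1 := by
  rw [thetaTri_v1_coords]
  ext i
  fin_cases i <;> simp [v] <;> norm_num

/-- The empty star is `𝟙`. -/
theorem V_fin_zero (a : Fin 0 → ℝ) : V a = 1 := by
  ext j
  simp [V_apply]

/-- A one-leaf star is its leaf. -/
theorem V_fin_one (a : Fin 1 → ℝ) : V a = v (a 0) := by
  ext j
  simp [V_apply]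

/-- **THE LAST SEED, EVERY STAR**: `θ_△(v 1, V a) ∈ cone` for every star `V a`, `a : Fin m → ℝ`, leaves in `[0, 1]`,
every `m` (the empty star, the one-leaf star of `C041TriangleMarkLeaf`, and `InCone_thetaTri_v1_V_all`). -/
theorem InCone_thetaTri_v1_V {m : ℕ} (a : Fin m → ℝ) (ha : ∀ i, 0 ≤ a i ∧ a i ≤ 1) :
    InCone (thetaTri (v 1) (V a)) := by
  match m, a, ha with
  | 0, a, _ =>
    rw [V_fin_zero a, thetaTri_v1_one]
    exact InCone.add (InCone.smul _ (by norm_num) InCone_one)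
      (InCone.smul _ (by norm_num) (InCone_v 1 ⟨zero_le_one, le_rfl⟩))
  | 1, a, ha =>
    rw [V_fin_one a]
    simpa using InCone_thetaTri_pow_one_v 1 le_rfl (a 0) (ha 0)
  | m + 2, a, ha => exact InCone_thetaTri_v1_V_all a ha

end RelaxedTriangle

end PercRepro
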